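import Literature.NumberTheory.EllipticCurves.CuspFormTwist
import Literature.NumberTheory.EllipticCurves.CuspFormTwistAtkinLehnerProofs
import Literature.NumberTheory.EllipticCurves.AtkinLehnerInvolutions
import Literature.NumberTheory.EllipticCurves.Newforms
import Summits.BirchSwinnertonDyer.Rank1Residual.ManinAdditive.NeronOmegaGenusHecke
import HarnessLib
import HarnessLib.Audit.Tags

/-!
# «TWIST-MINIMAL ⟺ ATKIN–LEHNER +1 AT 9» — rows E-imc-172 (T)/(T′) and E-imc-176 typed, the `w₉ = −1` consequence of E-170 PROVED,
# and the twist half of E-172 from the tree's Atkin–Lehner-of-twist theorem (cell `bsd-f2-manin`, planner `imc` g22, MEMO-imc (28.16)–(28.17″);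
# T-imc-33; nothing asserted)

TYPER NOTE (typer g18, T-imc-33).  SOURCE = HOME/imc/kit-g22/Sketch-imc-g22e.lean v3 sha16 8a8098cec5a74e0e (104 l.; farm rc 0 · 0 err · 0 warn · 0 sorry
per imc; BC7 3/3 CLEAN), landed VERBATIM except: (i) this note; (ii) namespace `…ManinAdditive.NeronOmegaGenusG22e` folded to
`…ManinAdditive.NeronOmegaGenus` (where E-165…171 live); (iii) `import HarnessLib.Audit.CruxProbe` and the three `#h21_crux_probe` commands dropped
(probes are not tree content); (iv) ONE typer edge added — **the «twist ⟹ w₉ = −1» half of E-imc-172 is a TREE THEOREM**: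
`atkinLehnerEigenvalueAt_twist_level_eq_neg_one` / `atkinLehnerEigenvalueAt_twist_threeLevel_eq_neg_one` are one-liners over
`Literature…CuspFormTwistAtkinLehnerProofs.atkinLehnerEigenvalueAt_charTwist_of_eq_of_isPrimitive` (`λ_p(f_χ) = χ(−1)` at level `M p²`,
Atkin–Lehner 1970 §6 / Atkin–Li 1978 §3), stated with the oddness `χ(−1) = −1` and primitivity of `χ` as explicit hypotheses (both automatic for
the non-trivial quadratic character mod 3; not derived here).  So the OPEN content of E-imc-172 is the converse («w₉ = −1 ⟹ twist») and (T′)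
(«twist-minimal ⟹ w₉ = +1», i.e. the local root number of the conductor-9 supercuspidal types with trivial central character) — imc: «presumably
classical», placement ask R-imc-68 (ref1) pending; nothing else changed.  Imports are Literature + the route-independent leaf `NeronOmegaGenusHecke`
— ROUTE-INDEPENDENT.

HONEST FRAMING.  LENS: imc (integrality of modular forms / the Ω-lattice at additive level 9M).  E-imc-172 is E-blind and presumably IN PRINT up to
assembly (local ε-factors of `GL₂(ℚ₃)` representations of conductor 9 with trivial central character; twist formula `w_{p²}(h ⊗ χ_p) = χ_p(−1)` —
the latter is the tree theorem used in (iv)); filed as obligation nodes with the ENGINE 13 table as BC5 witness until ref1/ref2 place it; E-imc-176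
is a THEOREM-candidate from E-170 (needs `w₉` self-adjointness for `peterssonProductₗ`, prover ask).  BC5 WITNESS: HOME/imc/kit-g22/g22-eng13-partners-p3.txt
sha16 f3f63654edd41235 (+ …-873-1296.txt 19ae7286aefe9ad9; kit j326542/j326823): 422/422 newform Galois orbits at `9 ∥ N ≤ 864` (`w₉ = −1` ⟺
χ₋₃-twist of level M or 3M: 275/275; twist-minimal ⟹ `+1`: 147/147), 0 exceptions; E-facing TABLE v1.1: at `v₃(N) = 2`, `w₃(E) = +1 ⟺` type SC
(2213), `w₃ = −1 ⟺` Sp/PS (6411), 8624/8624; ENGINE 7: `σ^Ω = 1 ⟹ w₃ = +1` 59/59, `w₃ = −1 ⟹ σ^Ω = 0` 345/345.  WHY IT MATTERS (imc): with E-170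
(`W = +1` on the Ω-defect) and E-150, the Manin-at-3 residual at `9 ∥ N` is confined to SUPERCUSPIDAL-at-3 curves (then to III*, E-153a) — the
local invariant at 3 for `v₃(N) = 2` is the twist-minimal conductor-9 type.  REFUTER VERDICTS: R-imc-68 (ref1) PENDING at filing; ref2 PENDING.
PARTITION currency: 0 (E-blind laws; C3's partition unchanged); beyond-print theorem: NO; bears_on: stmt-BirchSwinnertonDyer-22968 (C3
`ManinPrimeToThreeAtNine`).  BSD is not proved by this; Manin's conjecture is not proved; C2/C3 OPEN.
[cite: AtkinLehner1970, §6 (W-operators and twists; the tree theorem `atkinLehnerEigenvalueAt_charTwist`: λ_p(f_χ) = χ(−1) at level Mp²)]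
[cite: AtkinLi1978, §3 (twists of newforms and their pseudo-eigenvalues; shape of E-imc-172 — the biconditional at level 9M is the cell's row, MEMO-imc (28.16), placement pending)]
[cite: Edixhoven2006IntegralStructures, Prop. 5 (shape of the Ω-lattice comparison behind E-170/E-176; NOT the statement)]
-/

open scoped MatrixGroups ModularForm
open CongruenceSubgroup Literature.NumberTheory.EllipticCurves.ModularForms
  Summit.BirchSwinnertonDyer.Rank1Residual.ManinAdditive
  Summit.BirchSwinnertonDyer.Rank1Residual.ManinAdditive.NeronCuspThree
  Summit.BirchSwinnertonDyer.Rank1Residual.ManinAdditive.NeronOmegaThree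
  Summit.BirchSwinnertonDyer.Rank1Residual.ManinAdditive.NeronOmegaGenus

namespace Summit.BirchSwinnertonDyer.Rank1Residual.ManinAdditive.NeronOmegaGenus


/-- E-imc-172 (T): for `3 ∤ M` and a newform `g ∈ S₂(Γ₀(9M))^{new}`, the Atkin–Lehner eigenvalue at 3 is
`−1` iff `g` is the twist by the quadratic character mod 3 of a newform of level `M` or of level `3M`
(equivalently, by `λ = ±1`: it is `+1` iff `g` is twist-minimal at 3).  ENGINE 13: 422/422 orbits.
[conjecture-tagged candidate; cell bsd-f2-manin imc g22] -/
@[conjecture] def TwistIffAtkinLehnerMinusAtNine : Prop :=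
  ∀ (M : ℕ) [NeZero M] [NeZero (3 * M)] [NeZero (9 * M)], ¬ 3 ∣ M →
  ∀ (χ : DirichletCharacter ℂ 3), χ.IsQuadratic → χ ≠ 1 →
  ∀ (hχ : χ.IsQuadratic) (g : CuspForm (Gamma0 (9 * M)) 2), IsNewform0 g →
    (atkinLehnerEigenvalueAt g 3 = -1 ↔
      ((∃ h : CuspForm (Gamma0 M) 2, IsNewform0 h ∧
          g = charTwist (9 * M) (dvd_mul_left M 9) (Dvd.intro M (by norm_num)) hχ h) ∨
       (∃ h : CuspForm (Gamma0 (3 * M)) 2, IsNewform0 h ∧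
          g = charTwist (9 * M) (mul_dvd_mul_right (by norm_num : (3 : ℕ) ∣ 9) M)
                (Dvd.intro M (by norm_num)) hχ h)))

/-- E-imc-172 (T′), the `+1` half stated on its own: a newform of level `9M` (`3 ∤ M`) that is NOT a
`χ₋₃`-twist of a newform of level `M` or `3M` has Atkin–Lehner eigenvalue `+1` at 3 (ENGINE 13: 147/147
twist-minimal orbits). [conjecture-tagged candidate; cell bsd-f2-manin imc g22] -/
@[conjecture] def AtkinLehnerPlusOfTwistMinimalAtNine : Prop :=
  ∀ (M : ℕ) [NeZero M] [NeZero (3 * M)] [NeZero (9 * M)], ¬ 3 ∣ M →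
  ∀ (χ : DirichletCharacter ℂ 3) (hχ : χ.IsQuadratic), χ ≠ 1 →
  ∀ g : CuspForm (Gamma0 (9 * M)) 2, IsNewform0 g →
    (¬ ∃ h : CuspForm (Gamma0 M) 2, IsNewform0 h ∧
          g = charTwist (9 * M) (dvd_mul_left M 9) (Dvd.intro M (by norm_num)) hχ h) →
    (¬ ∃ h : CuspForm (Gamma0 (3 * M)) 2, IsNewform0 h ∧
          g = charTwist (9 * M) (mul_dvd_mul_right (by norm_num : (3 : ℕ) ∣ 9) M)
                (Dvd.intro M (by norm_num)) hχ h) →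
    atkinLehnerEigenvalueAt g 3 = 1

/-! ## §2 A PROVED consequence of E-170 (in tree: `NeronOmegaGenus.OmegaDefectFrickeTrivialAtNine`): the `w₉ = −1` sector of `L_red` lies in `Ω₃`

ENGINE 13 / TABLE v1.1: at `9 ∥ N` the optimal curves with `w₃(E) = −1` are exactly the non-twist-minimal ones
(types PS and Sp(pot. mult.), 6411 of 8624 curves with `v₃(N) = 2`); for them the line `ℤ f_E` meets the Ω-defect
trivially.  ENGINE 7 census: `σ^Ω = 1 ⟹ w₃(E) = +1` at `9 ∥ N`, 59/59 (all III*); `w₃(E) = −1 ⟹ σ^Ω = 0`, 345/345. -/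

/-- **E-170 ⟹ the `W = −1` part of `L_red(9M)` is 3-adically inside `Ω₃(9M)`**: if `w₉ x = −x` for
`x ∈ L_red`, then `2x = −(w₉ x − x)` lies 3-adically in `Ω₃`, and `2` is a 3-adic unit.  Hence (E-facing, words) for an
optimal `E` of conductor `9M` with `w₃(E) = −1` — equivalently (E-172 / TABLE v1.1, 8624/8624) `E` not twist-minimal at 3 —
the newform line cannot see the Ω-defect: `σ^Ω(E) = 0` (ENGINE 7: 345/345). [proved from the conjecture-tagged E-170] -/
theorem isThreeAdicMem_omega_of_atkinLehner_neg (h170 : OmegaDefectFrickeTrivialAtNine) (M : ℕ) [NeZero M]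
    (hM : ¬ 3 ∣ M) {x : CuspForm (Gamma0 (9 * M)) 2} (hx : x ∈ reducedCuspLatticeAtThree (9 * M))
    (hW : atkinLehnerInvolutionAt (9 * M) 2 3 x = -x) :
    IsThreeAdicMem (omegaLatticeAtThree (9 * M)) x := by
  obtain ⟨m, hm3, hm⟩ := h170 M hM x hx
  refine ⟨2 * m, ?_, ?_⟩
  · intro h
    rcases (Nat.Prime.dvd_mul Nat.prime_three).mp h with h2 | h2
    · exact absurd h2 (by norm_num)
    · exact hm3 h2
  · have key : ((2 * m : ℕ) : ℂ) • x = -((m : ℂ) • (atkinLehnerInvolutionAt (9 * M) 2 3 x - x)) := by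
      rw [hW]; push_cast; module
    rw [key]
    exact (omegaLatticeAtThree (9 * M)).neg_mem hm

/-- **E-imc-176 `OmegaLineDepthEqReducedOfAtkinLehnerNegAtNine`** (THEOREM-candidate, follows from E-170 on paper by MEMO-imc
(28.17′): `e_f ∘ w₉ = −e_f` for a `w₉ = −1` eigenvector `f`, so `2·e_f(x) = −e_f((w₉ − 1)x) ∈ e_f(Ω₃)` for `x ∈ L_red`; typed here
so that a prover can discharge it from `OmegaDefectFrickeTrivialAtNine`): at `N = 9M`, `3 ∤ M`, for `f` with `w₉ f = −f` the `f`-line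
indices of `Ω₃(N)` and `L_red(N)` have the same 3-adic order — the Ω-defect is invisible on the line of any `w₉ = −1` form (E-facing:
σ^Ω(E) = σ_red(E) for `w₃(E) = −1`, ENGINE 7: 345/345).  Why it might fail: only with E-170; junk value `lineIndex = 0` on both
sides if the quotients are infinite (then trivially true). -/
@[conjecture] def OmegaLineDepthEqReducedOfAtkinLehnerNegAtNine : Prop :=
  ∀ (M : ℕ) [NeZero M] [NeZero (9 * M)], ¬ 3 ∣ M → ∀ f : CuspForm (Gamma0 (9 * M)) 2,
    atkinLehnerInvolutionAt (9 * M) 2 3 f = -f →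
      padicValNat 3 (lineIndex (omegaLatticeAtThree (9 * M)) f) =
        padicValNat 3 (lineIndex (reducedCuspLatticeAtThree (9 * M)) f)

/-! ## §1b Typer edge: the «twist ⟹ `w₉ = −1`» half of E-imc-172 is the tree's Atkin–Lehner-of-twist theorem -/

/-- **Half of E-imc-172 (T) is a TREE THEOREM (level `M` case):** for `3 ∤ M`, a newform `h` of level `M` and an ODD primitive quadratic
character `χ` mod `3` (the non-trivial one is both), the twist `h ⊗ χ` at level `9M` has Atkin–Lehner eigenvalue `χ(−1) = −1` at `3` —
`atkinLehnerEigenvalueAt_charTwist_of_eq_of_isPrimitive` (Atkin–Lehner 1970 §6 / Atkin–Li 1978 §3, tree) with `a₁(h) = 1`. -/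
theorem atkinLehnerEigenvalueAt_twist_level_eq_neg_one (M : ℕ) [NeZero M] [NeZero (9 * M)] (hM : ¬ 3 ∣ M)
    (χ : DirichletCharacter ℂ 3) (hχ : χ.IsQuadratic) (hprim : χ.IsPrimitive) (hodd : χ (-1) = -1)
    (h : CuspForm (Gamma0 M) 2) (hh : IsNewform0 h) :
    atkinLehnerEigenvalueAt (charTwist (9 * M) (dvd_mul_left M 9) (Dvd.intro M (by norm_num)) hχ h) 3 = -1 := by
  haveI : Fact (Nat.Prime 3) := ⟨Nat.prime_three⟩
  have h1 : cuspCoeff h 1 ≠ 0 := by rw [show cuspCoeff h 1 = 1 from hh.2.2]; exact one_ne_zero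
  rw [← hodd]
  exact atkinLehnerEigenvalueAt_charTwist_of_eq_of_isPrimitive (M := M) (N := M) (L := 9 * M) (by ring) hM
    (dvd_mul_right M 3) _ _ hχ hprim h1

/-- **Half of E-imc-172 (T) is a TREE THEOREM (level `3M` case):** same for a newform `h` of level `3M`. -/
theorem atkinLehnerEigenvalueAt_twist_threeLevel_eq_neg_one (M : ℕ) [NeZero M] [NeZero (3 * M)] [NeZero (9 * M)] (hM : ¬ 3 ∣ M)
    (χ : DirichletCharacter ℂ 3) (hχ : χ.IsQuadratic) (hprim : χ.IsPrimitive) (hodd : χ (-1) = -1)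
    (h : CuspForm (Gamma0 (3 * M)) 2) (hh : IsNewform0 h) :
    atkinLehnerEigenvalueAt (charTwist (9 * M) (mul_dvd_mul_right (by norm_num : (3 : ℕ) ∣ 9) M)
      (Dvd.intro M (by norm_num)) hχ h) 3 = -1 := by
  haveI : Fact (Nat.Prime 3) := ⟨Nat.prime_three⟩
  have h1 : cuspCoeff h 1 ≠ 0 := by rw [show cuspCoeff h 1 = 1 from hh.2.2]; exact one_ne_zero
  rw [← hodd]
  exact atkinLehnerEigenvalueAt_charTwist_of_eq_of_isPrimitive (M := M) (N := 3 * M) (L := 9 * M) (by ring) hM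
    (by rw [mul_comm]) _ _ hχ hprim h1

end Summit.BirchSwinnertonDyer.Rank1Residual.ManinAdditive.NeronOmegaGenus
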